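import Summits.NavierStokesRegularity.NavierStokesRegularity.Theorems.LerayQuarterDissipationRecurrentReductionDRecurrent
import Summits.NavierStokesRegularity.NavierStokesRegularity.Theorems.LerayQuarterDissipationFiniteDissipationLiouvilleHullCategoryDilate
import HarnessLib

/-!
# Crux `FiniteDissipationLiouville` (stmt-NavierStokesRegularity-22144), line `birth`:
# MINIMALITY OF THE SCALING HULL — every scaling limit of a uniformly recurrent member of
# `𝒟_{C,K}` is uniformly recurrent

Helper file (theorems only, `--supports` the crux). Let `𝒟_{C,K}` be the finite-dissipation
stratum of the route (Type-I ancient mild fields in the KNSS gauge with the quarter-rate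
dissipation law), acted on by the scaling flow `σ ↦ w_{e^σ}` (`nsRescale`). The crux is the
emptiness of the classes of SINGULAR, UNIFORMLY RECURRENT members ("critical elements",
`…CriticalRecurrent`, `…Lyapunov`); the category clause (`…HullCategory`, lead g11) produces
scaling limits of a wandering critical element off any countable family of scaling orbits. This
file shows that those limits are again critical elements:

* `recurrent_of_orbitLimit` — if `u ∈ 𝒟_{C,K}` is UNIFORMLY RECURRENT under the scaling flow (the
  item's window clause) and `W ∈ 𝒟_{C,K}` is a scaling limit of `u` (uniform on the slab pieces
  along rescalings `u_{l_k}`, `l_k > 0`), then `W` is uniformly recurrent with the same clause.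
  This is Birkhoff's "the orbit closure of a uniformly recurrent point is MINIMAL, and every point
  of a compact minimal set is uniformly recurrent" (Furstenberg 1981, Thms. 1.15–1.17) in the
  kernel's clauses, in the model of `…RecurrentReductionDRecurrentUnif` (abstract antecedent for
  JOINTLY continuous actions: `Literature.Dynamics.TopologicalDynamics.MinimalOrbitClosure`; here
  bounded correction times + equicontinuity of the scaling flow over bounded times replace joint
  continuity), then `isUniformlyRecurrentPt_of_mem_closure_orbit` and the unwinding of `…RecurrentUnif`.

With `…HullCategoryPortrait` and persistence: the scaling hull of a wandering critical element
consists of critical elements and is not covered by countably many scaling orbits. No summit is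
proved by this file; Navier–Stokes regularity is NOT proved by anything here; the crux stays FRONTIER.

References: H. Furstenberg, *Recurrence in Ergodic Theory and Combinatorial Number Theory* (1981),
Ch. 1 §4, Thms. 1.15–1.17 [Furstenberg1981]; G. Koch, N. Nadirashvili, G. Seregin, V. Šverák,
Acta Math. 203 (2009) = arXiv:0709.3599, §4 [KochNadirashviliSereginSverak2009].
-/

noncomputable section

-- the summit and its single problem share the name (D-0017 nested layout)
set_option linter.dupNamespace false

namespace Summit.NavierStokesRegularity.NavierStokesRegularity.Theorems.FiniteDissipationLiouville.HullCategory

open scoped Topology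
open MeasureTheory Set Function Filter Metric TopologicalSpace Topology
open Literature.Analysis.FluidPDE
open Literature.Dynamics.TopologicalDynamics
open Summit.NavierStokesRegularity.NavierStokesRegularity.Theorems.RecurrentReductionD

/-- **Every scaling limit of a uniformly recurrent member of `𝒟_{C,K}` is uniformly recurrent**
(minimality of the scaling hull; Birkhoff / Furstenberg 1981 Thms. 1.15–1.17, in the kernel's
window clause). Let `u ∈ 𝒟_{C,K}` satisfy the uniform scaling-recurrence clause of the item and
let `W ∈ 𝒟_{C,K}` be the uniform limit on every slab piece `[−(n+2), −1/(n+2)] × B̄(0, n+2)` of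
rescalings `u_{l_k}`, `l_k > 0`. Then `W` satisfies the same clause: for all `ε > 0`, `R > 1`
there is `L > 0` such that every window `[a, a + L]` contains `σ` with
`‖e^σ W(e^{2σ}s, e^σ y) − W(s, y)‖ ≤ ε` on `[−R², −R⁻²] × B̄(0, R)`.
[cite: Furstenberg1981, Ch. 1 §4, Thms. 1.15–1.17] -/
theorem recurrent_of_orbitLimit {C K : ℝ}
    {u : ℝ → EuclideanSpace ℝ (Fin 3) → EuclideanSpace ℝ (Fin 3)}
    (hu : IsTypeIAncientMild C u)
    (hlaw : ∀ s : ℝ, s < 0 → ∫⁻ x, ‖fderiv ℝ (u s) x‖ₑ ^ 2 ≤ ENNReal.ofReal (K / Real.sqrt (-s)))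
    (hrec : ∀ ε > 0, ∀ R > 1, ∃ L > 0, ∀ a : ℝ, ∃ σ ∈ Icc a (a + L),
      ∀ s ∈ Icc (-(R ^ 2)) (-(R⁻¹) ^ 2), ∀ y ∈ closedBall (0 : EuclideanSpace ℝ (Fin 3)) R,
        ‖Real.exp σ • u (Real.exp (2 * σ) * s) (Real.exp σ • y) - u s y‖ ≤ ε)
    (l : ℕ → ℝ) (hl : ∀ k, 0 < l k)
    {W : ℝ → EuclideanSpace ℝ (Fin 3) → EuclideanSpace ℝ (Fin 3)} (hW : IsTypeIAncientMild C W)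
    (hlawW : ∀ s : ℝ, s < 0 → ∫⁻ x, ‖fderiv ℝ (W s) x‖ₑ ^ 2 ≤ ENNReal.ofReal (K / Real.sqrt (-s)))
    (hWu : ∀ n : ℕ, TendstoUniformlyOn (fun k z => nsRescale (l k) u z.1 z.2) (fun z => W z.1 z.2)
      atTop (Icc (-((n : ℝ) + 2)) (-(1 / ((n : ℝ) + 2))) ×ˢ
        closedBall (0 : EuclideanSpace ℝ (Fin 3)) ((n : ℝ) + 2))) :
    ∀ ε > 0, ∀ R > 1, ∃ L > 0, ∀ a : ℝ, ∃ σ ∈ Icc a (a + L),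
      ∀ s ∈ Icc (-(R ^ 2)) (-(R⁻¹) ^ 2), ∀ y ∈ closedBall (0 : EuclideanSpace ℝ (Fin 3)) R,
        ‖Real.exp σ • W (Real.exp (2 * σ) * s) (Real.exp σ • y) - W s y‖ ≤ ε := by
  classical
  -- ## the hull: the class `𝒟_{C,K}`
  set P : (ℝ → EuclideanSpace ℝ (Fin 3) → EuclideanSpace ℝ (Fin 3)) → Prop := fun p =>
    IsTypeIAncientMild C p ∧
      ∀ s : ℝ, s < 0 → ∫⁻ x, ‖fderiv ℝ (p s) x‖ₑ ^ 2 ≤ ENNReal.ofReal (K / Real.sqrt (-s))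
    with hP
  have hPz : ∀ p, P p → ∀ c : ℝ, 0 < c → P (nsRescale c p) := by
    rintro p ⟨h1, h2⟩ c hc
    exact ⟨isTypeIAncientMild_nsRescale h1 hc, dissipationLaw_nsRescale h2 hc⟩
  let X := {p : ℝ → EuclideanSpace ℝ (Fin 3) → EuclideanSpace ℝ (Fin 3) // P p}
  -- the slab pieces
  set T : ℕ → Set (ℝ × EuclideanSpace ℝ (Fin 3)) := fun n =>
    Icc (-((n : ℝ) + 2)) (-(1 / ((n : ℝ) + 2))) ×ˢ
      closedBall (0 : EuclideanSpace ℝ (Fin 3)) ((n : ℝ) + 2) with hT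
  haveI hTc : ∀ n, CompactSpace (T n) := fun n =>
    isCompact_iff_compactSpace.1 (isCompact_slabPiece n)
  have hTsub : ∀ n, T n ⊆ Iio (0:ℝ) ×ˢ (univ : Set (EuclideanSpace ℝ (Fin 3))) := fun n z hz =>
    ⟨neg_of_mem_slabPiece hz, mem_univ _⟩
  have hTmono : ∀ {i m : ℕ}, i ≤ m → T i ⊆ T m := by
    intro i m him z hz
    obtain ⟨⟨h1, h2⟩, h3⟩ := mem_slabPiece.1 hz
    have him' : (i : ℝ) ≤ (m : ℝ) := by exact_mod_cast him
    have hi0 : (0 : ℝ) < (i : ℝ) + 2 := by positivity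
    refine mem_slabPiece.2 ⟨⟨by linarith, h2.trans ?_⟩, h3.trans (by linarith)⟩
    exact neg_le_neg (one_div_le_one_div_of_le hi0 (by linarith))
  -- ## the model map and the topology
  have hcW : ∀ (p : X) (n : ℕ), Continuous fun z : T n => p.1 z.1.1 z.1.2 := fun p n =>
    continuousOn_iff_continuous_restrict.1 (p.2.1.continuousOn_uncurry.mono (hTsub n))
  let Φ : X → ((n : ℕ) → C(T n, EuclideanSpace ℝ (Fin 3))) := fun p n =>
    ⟨fun z => p.1 z.1.1 z.1.2, hcW p n⟩
  letI tX : TopologicalSpace X := TopologicalSpace.induced Φ inferInstance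
  have hΦ : IsInducing Φ := ⟨rfl⟩
  haveI hXm : PseudoMetrizableSpace X := hΦ.pseudoMetrizableSpace
  -- convergence in `X` is uniform convergence on every piece
  have htend : ∀ (x : ℕ → X) (a : X), Tendsto x atTop (𝓝 a) ↔
      ∀ n, TendstoUniformlyOn (fun j z => (x j).1 z.1 z.2) (fun z => a.1 z.1 z.2) atTop (T n) := by
    intro x a
    rw [hΦ.tendsto_nhds_iff, tendsto_pi_nhds]
    constructor
    · intro h n
      have h1 := h n
      rw [ContinuousMap.tendsto_iff_tendstoUniformly] at h1
      rw [tendstoUniformlyOn_iff_tendstoUniformly_comp_coe]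
      exact h1
    · intro h n
      rw [ContinuousMap.tendsto_iff_tendstoUniformly]
      have h1 := h n
      rw [tendstoUniformlyOn_iff_tendstoUniformly_comp_coe] at h1
      exact h1
  have hdist_le : ∀ (p q : X) (n : ℕ) {ε : ℝ}, 0 ≤ ε →
      (∀ z ∈ T n, ‖p.1 z.1 z.2 - q.1 z.1 z.2‖ ≤ ε) → dist (Φ p n) (Φ q n) ≤ ε := by
    intro p q n ε hε h
    rw [ContinuousMap.dist_le hε]
    intro z
    rw [dist_eq_norm]
    exact h z.1 z.2
  have hdist_ge : ∀ (p q : X) (n : ℕ), ∀ z ∈ T n,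
      ‖p.1 z.1 z.2 - q.1 z.1 z.2‖ ≤ dist (Φ p n) (Φ q n) := by
    intro p q n z hz
    have h := ContinuousMap.dist_apply_le_dist (f := Φ p n) (g := Φ q n) ⟨z, hz⟩
    rwa [dist_eq_norm] at h
  have hdist_mono : ∀ (p q : X) {i m : ℕ}, i ≤ m → dist (Φ p i) (Φ q i) ≤ dist (Φ p m) (Φ q m) :=
    fun p q i m him => hdist_le p q i dist_nonneg fun z hz => hdist_ge p q m z (hTmono him hz)
  -- a neighbourhood of a point of `X` contains a sup-ball over ONE piece
  have hbasic : ∀ (a : X) (U : Set X), U ∈ 𝓝 a → ∃ (m : ℕ) (ε : ℝ), 0 < ε ∧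
      ∀ p : X, dist (Φ p m) (Φ a m) < ε → p ∈ U := by
    intro a U hU
    rw [hΦ.nhds_eq_comap, mem_comap] at hU
    obtain ⟨V, hV, hVU⟩ := hU
    rw [nhds_pi, Filter.mem_pi] at hV
    obtain ⟨I, hI, t, ht, htV⟩ := hV
    have hball : ∀ i, ∃ δ > 0, ball (Φ a i) δ ⊆ t i := fun i => Metric.mem_nhds_iff.1 (ht i)
    choose δ hδ hδt using hball
    obtain ⟨m, hm⟩ := hI.bddAbove
    -- a positive lower bound for the finitely many radii
    have hεex : ∃ ε > 0, ∀ i ∈ I, ε ≤ δ i := by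
      rcases I.eq_empty_or_nonempty with hIe | hIne
      · exact ⟨1, one_pos, fun i hi => by rw [hIe] at hi; exact hi.elim⟩
      · obtain ⟨i₀, hi₀, hmin⟩ := Set.exists_min_image I δ hI hIne
        exact ⟨δ i₀, hδ i₀, fun i hi => hmin i hi⟩
    obtain ⟨ε, hε, hεδ⟩ := hεex
    refine ⟨m, ε, hε, fun p hp => hVU ?_⟩
    show Φ p ∈ V
    refine htV fun i hi => hδt i ?_
    rw [mem_ball]
    exact ((hdist_mono p a (hm hi)).trans_lt hp).trans_le (hεδ i hi)
  -- ## the scaling flow on `X`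
  let ϕ : ℝ → X → X := fun σ p =>
    ⟨nsRescale (Real.exp σ) p.1, hPz p.1 p.2 (Real.exp σ) (Real.exp_pos σ)⟩
  have hadd : ∀ s t (p : X), ϕ (s + t) p = ϕ s (ϕ t p) := by
    intro s t p
    apply Subtype.ext
    show nsRescale (Real.exp (s + t)) p.1 = nsRescale (Real.exp s) (nsRescale (Real.exp t) p.1)
    rw [Real.exp_add, mul_comm, nsRescale_mul]
  -- Lipschitz control of `ϕ τ`, uniformly for `τ ∈ [0, L₀]`, from a dilated piece
  have hlip : ∀ {L₀ : ℝ}, 0 ≤ L₀ → ∀ n : ℕ, ∃ m : ℕ, n ≤ m ∧ ∀ τ : ℝ, 0 ≤ τ → τ ≤ L₀ →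
      ∀ p q : X, dist (Φ (ϕ τ p) n) (Φ (ϕ τ q) n) ≤ Real.exp L₀ * dist (Φ p m) (Φ q m) := by
    intro L₀ hL₀ n
    obtain ⟨m, hnm, hm⟩ := slabPiece_mapsTo_dilate_unif (Real.exp L₀) n
    refine ⟨m, hnm, fun τ hτ0 hτL p q => ?_⟩
    have hτ : 0 < Real.exp τ := Real.exp_pos τ
    have hτ1 : 1 ≤ Real.exp τ := Real.one_le_exp hτ0
    have hτL' : Real.exp τ ≤ Real.exp L₀ := Real.exp_le_exp.2 hτL
    refine hdist_le _ _ n (by positivity) fun z hz => ?_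
    have hzm := hm (Real.exp τ) hτ1 hτL' hz
    have h1 := hdist_ge p q m _ hzm
    show ‖nsRescale (Real.exp τ) p.1 z.1 z.2 - nsRescale (Real.exp τ) q.1 z.1 z.2‖ ≤ _
    rw [nsRescale_apply, nsRescale_apply, ← smul_sub, norm_smul, Real.norm_of_nonneg hτ.le]
    exact mul_le_mul hτL' h1 (norm_nonneg _) (Real.exp_pos L₀).le
  have hcont : ∀ σ, Continuous (ϕ σ) := by
    intro σ
    refine continuous_iff_seqContinuous.2 fun x a hxa => ?_
    rw [htend] at hxa ⊢
    have hl0 : 0 < Real.exp σ := Real.exp_pos σ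
    intro n
    obtain ⟨m, hm⟩ := slabPiece_mapsTo_dilate hl0 n
    rw [Metric.tendstoUniformlyOn_iff]
    intro ε hε
    filter_upwards [Metric.tendstoUniformlyOn_iff.1 (hxa m) (ε / Real.exp σ) (div_pos hε hl0)]
      with j hj z hz
    have h := hj (Real.exp σ ^ 2 * z.1, Real.exp σ • z.2) (hm hz)
    show dist (nsRescale (Real.exp σ) a.1 z.1 z.2) (nsRescale (Real.exp σ) (x j).1 z.1 z.2) < ε
    rw [nsRescale_apply, nsRescale_apply, dist_smul₀, Real.norm_of_nonneg hl0.le]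
    calc Real.exp σ * dist (a.1 (Real.exp σ ^ 2 * z.1) (Real.exp σ • z.2))
          ((x j).1 (Real.exp σ ^ 2 * z.1) (Real.exp σ • z.2))
        < Real.exp σ * (ε / Real.exp σ) := mul_lt_mul_of_pos_left h hl0
      _ = ε := mul_div_cancel₀ _ hl0.ne'
  -- the curve `τ ↦ ϕ τ y` is continuous on every piece (joint continuity on `ℝ × piece`, curried)
  have hcurve : ∀ (y : X) (n : ℕ), Continuous fun τ : ℝ => Φ (ϕ τ y) n := by
    intro y n
    have h1 : Continuous fun q : ℝ × T n => Real.exp q.1 := Real.continuous_exp.comp continuous_fst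
    have h2 : Continuous fun q : ℝ × T n => ((q.2 : ℝ × EuclideanSpace ℝ (Fin 3))) :=
      continuous_subtype_val.comp continuous_snd
    have hd : Continuous fun q : ℝ × T n =>
        ((Real.exp q.1) ^ 2 * (q.2 : ℝ × EuclideanSpace ℝ (Fin 3)).1,
          Real.exp q.1 • (q.2 : ℝ × EuclideanSpace ℝ (Fin 3)).2) :=
      ((h1.pow 2).mul (continuous_fst.comp h2)).prodMk (h1.smul (continuous_snd.comp h2))
    have hmaps : ∀ q : ℝ × T n,
        (((Real.exp q.1) ^ 2 * (q.2 : ℝ × EuclideanSpace ℝ (Fin 3)).1,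
          Real.exp q.1 • (q.2 : ℝ × EuclideanSpace ℝ (Fin 3)).2) : ℝ × EuclideanSpace ℝ (Fin 3)) ∈
          Iio (0 : ℝ) ×ˢ (univ : Set (EuclideanSpace ℝ (Fin 3))) := fun q =>
      ⟨mul_neg_of_pos_of_neg (pow_pos (Real.exp_pos q.1) 2) (neg_of_mem_slabPiece q.2.2),
        mem_univ _⟩
    have h3 := y.2.1.continuousOn_uncurry.comp_continuous hd hmaps
    have hj : Continuous fun q : ℝ × T n => nsRescale (Real.exp q.1) y.1 q.2.1.1 q.2.1.2 :=
      h1.smul h3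
    let F : C(ℝ × T n, EuclideanSpace ℝ (Fin 3)) := ⟨_, hj⟩
    have hF : (fun τ => Φ (ϕ τ y) n) = fun τ => F.curry τ := by
      funext τ
      exact ContinuousMap.ext fun z => rfl
    rw [hF]
    exact F.curry.continuous
  -- ## the base point and its orbit closure
  let x₀ : X := ⟨u, hu, hlaw⟩
  set S : Set X := closure (range fun σ => ϕ σ x₀) with hS
  have hSinv : ∀ t, MapsTo (ϕ t) S S := fun t => mapsTo_closure_orbit hcont hadd t x₀
  -- ## KEY: subsequential limits of orbit sequences
  have hkey : ∀ σs : ℕ → ℝ, ∃ (b : X) (ψ : ℕ → ℕ), StrictMono ψ ∧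
      Tendsto (fun j => ϕ (σs (ψ j)) x₀) atTop (𝓝 b) := by
    intro σs
    obtain ⟨ψ, hψ, W', hW', hlawW', hWu', -⟩ :=
      orbitLimit hu hlaw (fun k => Real.exp (σs k)) (fun k => Real.exp_pos _)
    refine ⟨⟨W', hW', hlawW'⟩, ψ, hψ, ?_⟩
    rw [htend]
    exact hWu'
  -- ## compactness of the orbit closure (sequential compactness in a pseudo-metrisable space)
  have hScpt : IsCompact S := by
    letI mX : PseudoMetricSpace X := TopologicalSpace.pseudoMetrizableSpacePseudoMetric X
    refine IsSeqCompact.isCompact fun x hx => ?_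
    have hnear : ∀ k : ℕ, ∃ σ : ℝ, dist (x k) (ϕ σ x₀) < 1 / ((k : ℝ) + 1) := by
      intro k
      have hk : (0 : ℝ) < 1 / ((k : ℝ) + 1) := by positivity
      obtain ⟨b, hb, hd⟩ := Metric.mem_closure_iff.1 (hx k) (1 / ((k : ℝ) + 1)) hk
      obtain ⟨σ, rfl⟩ := hb
      exact ⟨σ, hd⟩
    choose σs hσs using hnear
    obtain ⟨a, ψ, hψ, ha⟩ := hkey σs
    refine ⟨a, ?_, ψ, hψ, ?_⟩
    · exact isClosed_closure.mem_of_tendsto ha (Eventually.of_forall fun j => subset_closure ⟨_, rfl⟩)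
    · refine ha.congr_dist ?_
      have h1 : Tendsto (fun j => 1 / (((ψ j : ℕ) : ℝ) + 1)) atTop (𝓝 0) :=
        (tendsto_one_div_add_atTop_nhds_zero_nat (𝕜 := ℝ)).comp hψ.tendsto_atTop
      refine squeeze_zero (fun j => dist_nonneg) (fun j => ?_) h1
      rw [dist_comm]
      exact (hσs (ψ j)).le
  -- ## the given limit `W` lies in the orbit closure
  let w : X := ⟨W, hW, hlawW⟩
  have hwS : w ∈ S := by
    have hlim : Tendsto (fun k => ϕ (Real.log (l k)) x₀) atTop (𝓝 w) := by
      rw [htend]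
      intro n
      refine (hWu n).congr (Eventually.of_forall fun k z _ => ?_)
      show nsRescale (l k) u z.1 z.2 = nsRescale (Real.exp (Real.log (l k))) u z.1 z.2
      rw [Real.exp_log (hl k)]
    exact mem_closure_of_tendsto hlim (Eventually.of_forall fun k => ⟨_, rfl⟩)
  -- ## MINIMALITY: the base point lies in the orbit closure of every point of `S`
  have hmin : ∀ y ∈ S, x₀ ∈ closure (range fun t => ϕ t y) := by
    intro y hy
    letI mX : PseudoMetricSpace X := TopologicalSpace.pseudoMetrizableSpacePseudoMetric X
    rw [mem_closure_iff_nhds]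
    intro U hU
    obtain ⟨m, ε, hε, hUsub⟩ := hbasic x₀ U hU
    -- return times of the base point at level `ε/2` on the window containing the piece `T m`
    have hm1 : (1 : ℝ) < (m : ℝ) + 2 := by linarith [m.cast_nonneg (α := ℝ)]
    obtain ⟨L, hL, hwin⟩ := hrec (ε / 2) (by positivity) ((m : ℝ) + 2) hm1
    -- equicontinuity of `ϕ τ`, `τ ∈ [0, L]`, on the piece `T m`
    obtain ⟨m₁, -, hm₁⟩ := hlip hL.le m
    -- `y` as a limit of orbit points
    obtain ⟨xs, hxs, hxy⟩ := mem_closure_iff_seq_limit.1 hy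
    choose s hs using hxs
    have hxy' : Tendsto (fun n => ϕ (s n) x₀) atTop (𝓝 y) := hxy.congr fun n => (hs n).symm
    -- corrections `τ n ∈ [0, L]` making `ϕ (s n + τ n) x₀` return `ε/2`-close on `T m`
    have hret : ∀ n : ℕ, ∃ τ : ℝ, τ ∈ Icc (0 : ℝ) L ∧
        ∀ z ∈ T m, ‖nsRescale (Real.exp (s n + τ)) u z.1 z.2 - u z.1 z.2‖ ≤ ε / 2 := by
      intro n
      obtain ⟨σ, hσ, hσw⟩ := hwin (s n)
      refine ⟨σ - s n, ⟨by linarith [hσ.1], by linarith [hσ.2]⟩, fun z hz => ?_⟩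
      obtain ⟨⟨h1, h2⟩, h3⟩ := mem_slabPiece.1 hz
      have hm0 : (0 : ℝ) < (m : ℝ) + 2 := by positivity
      have hz1 : z.1 ∈ Icc (-(((m : ℝ) + 2) ^ 2)) (-((((m : ℝ) + 2))⁻¹) ^ 2) := by
        constructor
        · have : (m : ℝ) + 2 ≤ ((m : ℝ) + 2) ^ 2 := by nlinarith
          linarith
        · have h4 : (((m : ℝ) + 2)⁻¹) ^ 2 ≤ 1 / ((m : ℝ) + 2) := by
            rw [inv_pow, one_div]
            exact inv_anti₀ hm0 (by nlinarith)
          linarith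
      have hz2 : z.2 ∈ closedBall (0 : EuclideanSpace ℝ (Fin 3)) ((m : ℝ) + 2) := by
        rw [mem_closedBall, dist_zero_right]; exact h3
      have e2 : Real.exp σ ^ 2 = Real.exp (2 * σ) := by rw [← Real.exp_nat_mul]; norm_num
      rw [add_sub_cancel, nsRescale_apply, e2]
      exact hσw z.1 hz1 z.2 hz2
    choose τ hτ hτw using hret
    obtain ⟨τ₀, hτ₀, φ, hφ, hτφ⟩ := tendsto_subseq_of_bounded (x := τ) (isBounded_Icc 0 L) hτ
    rw [closure_Icc] at hτ₀
    -- the orbit points `A n = ϕ (τ (φ n)) (ϕ (s (φ n)) x₀)` are `ε/2`-close to `x₀` on `T m` …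
    have hA₁ : ∀ n, dist (Φ (ϕ (τ (φ n)) (ϕ (s (φ n)) x₀)) m) (Φ x₀ m) ≤ ε / 2 := by
      intro n
      rw [← hadd]
      refine hdist_le _ _ m (by positivity) fun z hz => ?_
      rw [add_comm]
      exact hτw (φ n) z hz
    -- … and converge to `ϕ τ₀ y` on `T m`
    have hA₂ : Tendsto (fun n => Φ (ϕ (τ (φ n)) (ϕ (s (φ n)) x₀)) m) atTop (𝓝 (Φ (ϕ τ₀ y) m)) := by
      rw [tendsto_iff_dist_tendsto_zero]
      -- split: equicontinuity in the point + continuity of the curve of `y`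
      have hB : Tendsto (fun n => dist (Φ (ϕ (s (φ n)) x₀) m₁) (Φ y m₁)) atTop (𝓝 0) := by
        have h1 : Tendsto (fun n => Φ (ϕ (s (φ n)) x₀)) atTop (𝓝 (Φ y)) :=
          (hΦ.continuous.tendsto y).comp (hxy'.comp hφ.tendsto_atTop)
        have h2 := (continuous_apply m₁).continuousAt.tendsto.comp h1
        rw [tendsto_iff_dist_tendsto_zero] at h2
        exact h2
      have hCv : Tendsto (fun n => dist (Φ (ϕ (τ (φ n)) y) m) (Φ (ϕ τ₀ y) m)) atTop (𝓝 0) := by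
        have h1 := ((hcurve y m).continuousAt (x := τ₀)).tendsto.comp hτφ
        rw [tendsto_iff_dist_tendsto_zero] at h1
        exact h1
      have hsum : Tendsto (fun n => Real.exp L * dist (Φ (ϕ (s (φ n)) x₀) m₁) (Φ y m₁) +
          dist (Φ (ϕ (τ (φ n)) y) m) (Φ (ϕ τ₀ y) m)) atTop (𝓝 0) := by
        have := (hB.const_mul (Real.exp L)).add hCv
        simpa using this
      refine squeeze_zero (fun n => dist_nonneg) (fun n => ?_) hsum
      calc dist (Φ (ϕ (τ (φ n)) (ϕ (s (φ n)) x₀)) m) (Φ (ϕ τ₀ y) m)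
          ≤ dist (Φ (ϕ (τ (φ n)) (ϕ (s (φ n)) x₀)) m) (Φ (ϕ (τ (φ n)) y) m) +
              dist (Φ (ϕ (τ (φ n)) y) m) (Φ (ϕ τ₀ y) m) := dist_triangle _ _ _
        _ ≤ Real.exp L * dist (Φ (ϕ (s (φ n)) x₀) m₁) (Φ y m₁) +
              dist (Φ (ϕ (τ (φ n)) y) m) (Φ (ϕ τ₀ y) m) := by
            gcongr
            exact hm₁ (τ (φ n)) (hτ (φ n)).1 (hτ (φ n)).2 _ _
    -- hence `ϕ τ₀ y` is `ε/2`-close to `x₀` on `T m`, so it lies in `U`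
    have hle : dist (Φ (ϕ τ₀ y) m) (Φ x₀ m) ≤ ε / 2 :=
      le_of_tendsto' (hA₂.dist tendsto_const_nhds) hA₁
    exact ⟨ϕ τ₀ y, hUsub _ (by linarith), ⟨τ₀, rfl⟩⟩
  -- ## Birkhoff: `w` is uniformly recurrent in the model
  have hdense : ∀ y ∈ S, w ∈ closure (range fun t => ϕ t y) := by
    intro y hy
    have h1 : x₀ ∈ closure (range fun t => ϕ t y) := hmin y hy
    have h2 : S ⊆ closure (range fun t => ϕ t y) := by
      refine closure_minimal ?_ isClosed_closure
      rintro _ ⟨t, rfl⟩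
      exact mapsTo_closure_orbit hcont hadd t y h1
    exact h2 hwS
  have hwrec : IsUniformlyRecurrentPt ϕ w :=
    isUniformlyRecurrentPt_of_mem_closure_orbit hcont hadd hScpt hSinv hwS hdense
  -- ## unwinding uniform recurrence on the sup-ball of a piece containing the compact set
  intro ε hε R hR
  obtain ⟨n, hn⟩ := exists_nat_ge (R ^ 2)
  set U : Set X := {p : X | dist (Φ p n) (Φ w n) < ε} with hU
  have hUn : U ∈ 𝓝 w := by
    have h1 : Continuous fun p : X => Φ p n := (continuous_apply n).comp hΦ.continuous
    have o1 : IsOpen U := isOpen_lt (h1.dist continuous_const) continuous_const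
    refine o1.mem_nhds ?_
    show dist (Φ w n) (Φ w n) < ε
    rw [dist_self]; exact hε
  have hsyn := hwrec U hUn
  rw [isSyndetic_iff_exists_window] at hsyn
  obtain ⟨L, hL, hwin⟩ := hsyn
  refine ⟨L, hL, fun a' => ?_⟩
  obtain ⟨σ, hσ, hσU⟩ := hwin a'
  refine ⟨σ, hσ, fun s hs y hy => ?_⟩
  have hR0 : 0 < R := by linarith
  have hRn : R ^ 2 ≤ (n : ℝ) + 2 := by linarith
  have hz : ((s, y) : ℝ × EuclideanSpace ℝ (Fin 3)) ∈ T n := by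
    rw [mem_closedBall, dist_zero_right] at hy
    refine mem_slabPiece.2 ⟨⟨by linarith [hs.1], ?_⟩, ?_⟩
    · have h1 : 1 / ((n : ℝ) + 2) ≤ (R⁻¹) ^ 2 := by
        rw [inv_pow, one_div]
        exact inv_anti₀ (by positivity) hRn
      show s ≤ -(1 / ((n : ℝ) + 2))
      linarith [hs.2]
    · show ‖y‖ ≤ (n : ℝ) + 2
      nlinarith
  have hmem : ϕ σ w ∈ U := hσU
  have hd : dist (Φ (ϕ σ w) n) (Φ w n) < ε := hmem
  have h := (ContinuousMap.dist_apply_le_dist (f := Φ (ϕ σ w) n) (g := Φ w n) ⟨(s, y), hz⟩).trans_lt hd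
  rw [dist_eq_norm] at h
  have e2 : Real.exp σ ^ 2 = Real.exp (2 * σ) := by
    rw [← Real.exp_nat_mul]; norm_num
  have happ : (Φ (ϕ σ w) n) ⟨(s, y), hz⟩ = Real.exp σ • W (Real.exp (2 * σ) * s) (Real.exp σ • y) := by
    show nsRescale (Real.exp σ) W s y = _
    rw [nsRescale_apply, e2]
  rw [happ] at h
  exact h.le

end Summit.NavierStokesRegularity.NavierStokesRegularity.Theorems.FiniteDissipationLiouville.HullCategory

end
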